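import Literature.AlgebraicGeometry.Modules.SectionsExact
import Literature.AlgebraicGeometry.Modules.PushforwardClosedImmersionCoh
import Literature.AlgebraicGeometry.Modules.SheafHomFunctor
import Literature.AlgebraicGeometry.Modules.UnitCocycle
import Literature.AlgebraicGeometry.Deformation.SquareZeroExtensionObstruction
import HarnessLib

/-!
# Transporting sections of the ideal of a thickening to functions on a closed subscheme

Setting: morphisms of schemes `j : Y ⟶ Z₀`, `i : Z₀ ⟶ Z₁` and an isomorphism of `𝒪_{Z₁}`-modules

  `eI : i_* j_* 𝒪_Y ≅ 𝓘`,  `𝓘 = Ker(i♯ : 𝒪_{Z₁} → i_*𝒪_{Z₀})` (`Deformation.idealModule i`)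

— e.g. for the `p`-adic tower `X_k ↪ X_{n+1} ↪ X_{n+2}` of a smooth `W(k)`-scheme, where
`p^{n+1} : 𝒪_{X_k} ⥲ p^{n+1}𝒪_{X_{n+2}}` (route `HodgeConjecture/PadicSemiregularLift`, stub G3 of
crux `PadicPridhamSemiregularity`), or any first-order thickening `Z₀ ⊂ Z₁` with `𝓘 ≅ 𝒪_{Z₀}`
(`Y = Z₀`). On sections over an open `W ⊆ Z₁` this gives the dictionary used to read the defect of
lifted transition matrices (entries in `Ker(i♯)`, `Deformation/LiftedTransitions.lean`) as a Čech
cochain of functions on `Y`: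

* `toIdeal eI W : Γ(Y, j⁻¹i⁻¹W) →+ Γ(Z₁, W)` — additive, with image killed by `i♯` (`app_toIdeal`),
  injective (`toIdeal_injective`), onto `Ker(i♯)` (`exists_toIdeal_eq`), compatible with
  restriction (`toIdeal_map`) and **semilinear**: `toIdeal (ā y) = a · toIdeal y` where
  `ā = j♯ i♯ a` (`toIdeal_red_mul`);
* `ofIdeal eI W x hx` — the inverse on `x ∈ Ker(i♯)`;
* matrix forms: `T · H.map toIdeal = (T̄ · H).map toIdeal`, `H.map toIdeal · T = (H · T̄).map toIdeal`
  (`mul_map_toIdeal`, `map_toIdeal_mul`), the bridge between products of lifted matrices with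
  correction terms on `Z₁` and products of reduced matrices on `Y`.

Everything is proved; no named facts.

## References

* The Stacks Project, Tag 08KY (first order thickenings: `𝓘` is a module over `𝒪_X`). [StacksProject]
* R. Hartshorne, *Deformation Theory*, GTM 257 (2010), §7, proof of Thm. 7.1. [Hartshorne2010]
-/

noncomputable section

open CategoryTheory AlgebraicGeometry Opposite TopologicalSpace Limits

namespace Literature.AlgebraicGeometry.Deformation

open Literature.AlgebraicGeometry.Modules

universe u

variable {Y Z₀ Z₁ : Scheme.{u}} {j : Y ⟶ Z₀} {i : Z₀ ⟶ Z₁}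
  (eI : (Scheme.Modules.pushforward i).obj ((Scheme.Modules.pushforward j).obj (unitModule Y)) ≅
    idealModule i)

/-- The open `j⁻¹i⁻¹W ⊆ Y` under an open `W ⊆ Z₁`. [folklore] -/
abbrev baseOpen (j : Y ⟶ Z₀) (i : Z₀ ⟶ Z₁) (W : Z₁.Opens) : Y.Opens := j ⁻¹ᵁ (i ⁻¹ᵁ W)

/-- **Reduction of functions from `Z₁` to `Y`**: `a ↦ ā = j♯(i♯ a)` over `W`. [folklore] -/
def red (j : Y ⟶ Z₀) (i : Z₀ ⟶ Z₁) (W : Z₁.Opens) : Γ(Z₁, W) →+* Γ(Y, baseOpen j i W) :=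
  (j.app (i ⁻¹ᵁ W)).hom.comp (i.app W).hom

/-- Unfolding `red`. [folklore] -/
lemma red_apply (W : Z₁.Opens) (a : Γ(Z₁, W)) : red j i W a = j.app (i ⁻¹ᵁ W) (i.app W a) := rfl

/-- `red` kills `Ker(i♯)`. [folklore] -/
lemma red_eq_zero_of_app_eq_zero (W : Z₁.Opens) {a : Γ(Z₁, W)} (ha : i.app W a = 0) :
    red j i W a = 0 := by
  rw [red_apply, ha, map_zero]

/-- `red` commutes with restriction. [folklore] -/
lemma red_secRes {W W' : Z₁.Opens} (h : W' ≤ W) (a : Γ(Z₁, W)) :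
    red j i W' (secRes Z₁ h a) =
      secRes Y ((Opens.map j.base).map ((Opens.map i.base).map (homOfLE h))).le (red j i W a) := by
  rw [red_apply, red_apply]
  have h1 := ConcreteCategory.congr_hom (i.naturality (homOfLE h).op) a
  have h2 := ConcreteCategory.congr_hom (j.naturality ((Opens.map i.base).map (homOfLE h)).op)
    (i.app W a)
  exact (congrArg (j.app (i ⁻¹ᵁ W')) h1).trans h2

/-! ### Sections of `𝓘` from functions on `Y` -/

/-- **`toIdeal : Γ(Y, j⁻¹i⁻¹W) → Γ(Z₁, W)`**, `y ↦ ι(eI(y))`: a function on `Y` regarded as a section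
of the ideal `𝓘 ⊆ 𝒪_{Z₁}` through the isomorphism `eI : i_*j_*𝒪_Y ≅ 𝓘`. [cite: StacksProject, Tag 08KY] -/
def toIdeal (W : Z₁.Opens) : Γ(Y, baseOpen j i W) →+ Γ(Z₁, W) :=
  ((idealModuleι i).app W).hom.comp (eI.hom.app W).hom

/-- Unfolding `toIdeal`. [folklore] -/
lemma toIdeal_apply (W : Z₁.Opens) (y : Γ(Y, baseOpen j i W)) :
    toIdeal eI W y = (idealModuleι i).app W (eI.hom.app W y) := rfl

/-- **The image of `toIdeal` is killed by `i♯`.** [cite: StacksProject, Tag 08KY] -/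
theorem app_toIdeal (W : Z₁.Opens) (y : Γ(Y, baseOpen j i W)) : i.app W (toIdeal eI W y) = 0 :=
  app_kernel_ι_app (structureModuleMap i) W _

/-- `red ∘ toIdeal = 0`. [folklore] -/
lemma red_toIdeal (W : Z₁.Opens) (y : Γ(Y, baseOpen j i W)) : red j i W (toIdeal eI W y) = 0 :=
  red_eq_zero_of_app_eq_zero W (app_toIdeal eI W y)

/-- `eI.inv.app W` is a left inverse of `eI.hom.app W`. [folklore] -/
lemma inv_app_hom_app (W : Z₁.Opens) (y : Γ(Y, baseOpen j i W)) :
    eI.inv.app W (eI.hom.app W y) = y := by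
  change (eI.hom ≫ eI.inv).app W y = y
  rw [eI.hom_inv_id]
  rfl

/-- `eI.hom.app W` is a left inverse of `eI.inv.app W`. [folklore] -/
lemma hom_app_inv_app (W : Z₁.Opens) (m : Γ(idealModule i, W)) :
    eI.hom.app W (eI.inv.app W m) = m := by
  change (eI.inv ≫ eI.hom).app W m = m
  rw [eI.inv_hom_id]
  rfl

/-- **`toIdeal` is injective.** [folklore] -/
theorem toIdeal_injective (W : Z₁.Opens) : Function.Injective (toIdeal eI W) :=
  (kernel_ι_app_injective (structureModuleMap i) W).comp
    (Function.LeftInverse.injective (inv_app_hom_app eI W))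

/-- **`toIdeal` is onto `Ker(i♯)`.** [cite: StacksProject, Tag 08KY] -/
theorem exists_toIdeal_eq (W : Z₁.Opens) {x : Γ(Z₁, W)} (hx : i.app W x = 0) :
    ∃ y, toIdeal eI W y = x := by
  obtain ⟨m, hm⟩ := exists_kernel_ι_app_eq (structureModuleMap i) W x hx
  exact ⟨eI.inv.app W m, by rw [toIdeal_apply, hom_app_inv_app, hm]⟩

/-- **Semilinearity of `toIdeal`**: `toIdeal (ā · y) = a · toIdeal y` for `a ∈ Γ(Z₁, W)`,
`ā = j♯ i♯ a` (the `𝒪_{Z₁}`-module structure of `𝓘` is through `𝒪_Y`). [cite: StacksProject, Tag 08KY] -/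
theorem toIdeal_red_mul (W : Z₁.Opens) (a : Γ(Z₁, W)) (y : Γ(Y, baseOpen j i W)) :
    toIdeal eI W (red j i W a * y) = a * toIdeal eI W y := by
  have h1 : (red j i W a * y : Γ(Y, baseOpen j i W)) =
      (a • (show Γ((Scheme.Modules.pushforward i).obj
        ((Scheme.Modules.pushforward j).obj (unitModule Y)), W) from y)) := rfl
  rw [toIdeal_apply, h1, Scheme.Modules.Hom.app_smul, Scheme.Modules.Hom.app_smul]
  rfl

/-- `toIdeal (y · ā) = toIdeal y · a`. [folklore] -/
theorem toIdeal_mul_red (W : Z₁.Opens) (a : Γ(Z₁, W)) (y : Γ(Y, baseOpen j i W)) :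
    toIdeal eI W (y * red j i W a) = toIdeal eI W y * a := by
  rw [mul_comm, toIdeal_red_mul, mul_comm]

/-- **`toIdeal` commutes with restriction.** [folklore] -/
theorem toIdeal_map {W W' : Z₁.Opens} (h : W' ≤ W) (y : Γ(Y, baseOpen j i W)) :
    secRes Z₁ h (toIdeal eI W y) =
      toIdeal eI W' (secRes Y ((Opens.map j.base).map ((Opens.map i.base).map (homOfLE h))).le y) := by
  have h1 := ConcreteCategory.congr_hom ((idealModuleι i).mapPresheaf.naturality (homOfLE h).op)
    (eI.hom.app W y)
  have h2 := ConcreteCategory.congr_hom (eI.hom.mapPresheaf.naturality (homOfLE h).op) y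
  change (unitModule Z₁).presheaf.map (homOfLE h).op ((idealModuleι i).app W (eI.hom.app W y)) =
    (idealModuleι i).app W' (eI.hom.app W' (((Scheme.Modules.pushforward i).obj
      ((Scheme.Modules.pushforward j).obj (unitModule Y))).presheaf.map (homOfLE h).op y))
  exact h1.symm.trans (congrArg ((idealModuleι i).app W') h2).symm

/-! ### The inverse on `Ker(i♯)` -/

/-- **`ofIdeal x hx`**: the function on `Y` corresponding to a section `x ∈ Ker(i♯)` over `W`.
[cite: StacksProject, Tag 08KY] -/
def ofIdeal (W : Z₁.Opens) (x : Γ(Z₁, W)) (hx : i.app W x = 0) : Γ(Y, baseOpen j i W) :=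
  (exists_toIdeal_eq eI W hx).choose

/-- `toIdeal (ofIdeal x) = x`. [folklore] -/
@[simp]
theorem toIdeal_ofIdeal (W : Z₁.Opens) (x : Γ(Z₁, W)) (hx : i.app W x = 0) :
    toIdeal eI W (ofIdeal eI W x hx) = x :=
  (exists_toIdeal_eq eI W hx).choose_spec

/-- `ofIdeal (toIdeal y) = y`. [folklore] -/
@[simp]
theorem ofIdeal_toIdeal (W : Z₁.Opens) (y : Γ(Y, baseOpen j i W)) (h : i.app W (toIdeal eI W y) = 0) :
    ofIdeal eI W (toIdeal eI W y) h = y :=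
  toIdeal_injective eI W (toIdeal_ofIdeal eI W _ h)

/-- `ofIdeal` is additive. [folklore] -/
theorem ofIdeal_add (W : Z₁.Opens) (x x' : Γ(Z₁, W)) (hx : i.app W x = 0) (hx' : i.app W x' = 0)
    (h : i.app W (x + x') = 0) :
    ofIdeal eI W (x + x') h = ofIdeal eI W x hx + ofIdeal eI W x' hx' :=
  toIdeal_injective eI W (by rw [map_add, toIdeal_ofIdeal, toIdeal_ofIdeal, toIdeal_ofIdeal])

/-- `ofIdeal 0 = 0`. [folklore] -/
theorem ofIdeal_zero (W : Z₁.Opens) (h : i.app W (0 : Γ(Z₁, W)) = 0) : ofIdeal eI W 0 h = 0 :=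
  toIdeal_injective eI W (by rw [toIdeal_ofIdeal, map_zero])

/-- `ofIdeal` does not depend on the proof. [folklore] -/
theorem ofIdeal_congr (W : Z₁.Opens) {x x' : Γ(Z₁, W)} (hxx' : x = x') (hx : i.app W x = 0)
    (hx' : i.app W x' = 0) : ofIdeal eI W x hx = ofIdeal eI W x' hx' := by
  subst hxx'; rfl

/-! ### Matrix forms -/

section Matrix

variable {m n o : Type*}

/-- `i♯` kills `H.map toIdeal`. [folklore] -/
theorem map_map_toIdeal (W : Z₁.Opens) (H : Matrix m n Γ(Y, baseOpen j i W)) :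
    (H.map (toIdeal eI W)).map (i.app W).hom = 0 := by
  ext a b
  exact app_toIdeal eI W (H a b)

/-- **`T · H.map toIdeal = (T̄ · H).map toIdeal`** for `T` over `Z₁`, `H` over `Y`, `T̄ = red T`.
[folklore] -/
theorem mul_map_toIdeal [Fintype n] (W : Z₁.Opens) (T : Matrix m n Γ(Z₁, W)) (H : Matrix n o Γ(Y, baseOpen j i W)) :
    T * H.map (toIdeal eI W) = (T.map (red j i W) * H).map (toIdeal eI W) := by
  ext a b
  simp only [Matrix.mul_apply, Matrix.map_apply, map_sum, toIdeal_red_mul]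

/-- **`H.map toIdeal · T = (H · T̄).map toIdeal`.** [folklore] -/
theorem map_toIdeal_mul [Fintype m] (W : Z₁.Opens) (H : Matrix o m Γ(Y, baseOpen j i W))
    (T : Matrix m n Γ(Z₁, W)) :
    H.map (toIdeal eI W) * T = (H * T.map (red j i W)).map (toIdeal eI W) := by
  ext a b
  simp only [Matrix.mul_apply, Matrix.map_apply, map_sum, toIdeal_mul_red]

/-- `toIdeal` on matrices is injective. [folklore] -/
theorem matrix_map_toIdeal_injective (W : Z₁.Opens) :
    Function.Injective fun H : Matrix m n Γ(Y, baseOpen j i W) => H.map (toIdeal eI W) := by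
  intro H H' h
  ext a b
  exact toIdeal_injective eI W (congrFun (congrFun h a) b)

omit eI in
/-- Entries of a matrix killed by `i♯` are killed by `i♯`. [folklore] -/
lemma apply_eq_zero_of_map_eq_zero {W : Z₁.Opens} {A : Matrix m n Γ(Z₁, W)}
    (hA : A.map (i.app W).hom = 0) (a : m) (b : n) : i.app W (A a b) = 0 :=
  congrFun (congrFun hA a) b

/-- **A matrix over `Z₁` killed by `i♯` is `H.map toIdeal` for a unique matrix `H` over `Y`**
(`matrixOfIdeal`). [cite: StacksProject, Tag 08KY] -/
def matrixOfIdeal (W : Z₁.Opens) (A : Matrix m n Γ(Z₁, W)) (hA : A.map (i.app W).hom = 0) :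
    Matrix m n Γ(Y, baseOpen j i W) :=
  Matrix.of fun a b => ofIdeal eI W (A a b) (apply_eq_zero_of_map_eq_zero hA a b)

/-- `(matrixOfIdeal A).map toIdeal = A`. [folklore] -/
@[simp]
theorem map_toIdeal_matrixOfIdeal (W : Z₁.Opens) (A : Matrix m n Γ(Z₁, W))
    (hA : A.map (i.app W).hom = 0) : (matrixOfIdeal eI W A hA).map (toIdeal eI W) = A := by
  ext a b
  exact toIdeal_ofIdeal eI W (A a b) (apply_eq_zero_of_map_eq_zero hA a b)

/-- `matrixOfIdeal (H.map toIdeal) = H`. [folklore] -/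
@[simp]
theorem matrixOfIdeal_map_toIdeal (W : Z₁.Opens) (H : Matrix m n Γ(Y, baseOpen j i W))
    (h : (H.map (toIdeal eI W)).map (i.app W).hom = 0) : matrixOfIdeal eI W (H.map (toIdeal eI W)) h = H :=
  matrix_map_toIdeal_injective eI W (map_toIdeal_matrixOfIdeal eI W _ h)

/-- `matrixOfIdeal` is additive. [folklore] -/
theorem matrixOfIdeal_add (W : Z₁.Opens) (A B : Matrix m n Γ(Z₁, W)) (hA : A.map (i.app W).hom = 0)
    (hB : B.map (i.app W).hom = 0) (hAB : (A + B).map (i.app W).hom = 0) :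
    matrixOfIdeal eI W (A + B) hAB = matrixOfIdeal eI W A hA + matrixOfIdeal eI W B hB :=
  matrix_map_toIdeal_injective eI W (by
    simp only [map_toIdeal_matrixOfIdeal]
    rw [Matrix.map_add _ (map_add (toIdeal eI W)), map_toIdeal_matrixOfIdeal, map_toIdeal_matrixOfIdeal])

/-- `matrixOfIdeal` is compatible with subtraction. [folklore] -/
theorem matrixOfIdeal_sub (W : Z₁.Opens) (A B : Matrix m n Γ(Z₁, W)) (hA : A.map (i.app W).hom = 0)
    (hB : B.map (i.app W).hom = 0) (hAB : (A - B).map (i.app W).hom = 0) :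
    matrixOfIdeal eI W (A - B) hAB = matrixOfIdeal eI W A hA - matrixOfIdeal eI W B hB :=
  matrix_map_toIdeal_injective eI W (by
    simp only [Matrix.map_sub _ (map_sub (toIdeal eI W)), map_toIdeal_matrixOfIdeal])

/-- `matrixOfIdeal` does not depend on the proof and respects equalities. [folklore] -/
theorem matrixOfIdeal_congr (W : Z₁.Opens) {A B : Matrix m n Γ(Z₁, W)} (hAB : A = B)
    (hA : A.map (i.app W).hom = 0) (hB : B.map (i.app W).hom = 0) :
    matrixOfIdeal eI W A hA = matrixOfIdeal eI W B hB := by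
  subst hAB; rfl

/-- **`matrixOfIdeal (T · A) = T̄ · matrixOfIdeal A`**: left multiplication by a matrix over `Z₁`
becomes left multiplication by its reduction. [folklore] -/
theorem matrixOfIdeal_mul_left [Fintype n] (W : Z₁.Opens) (T : Matrix m n Γ(Z₁, W)) (A : Matrix n o Γ(Z₁, W))
    (hA : A.map (i.app W).hom = 0) (hTA : (T * A).map (i.app W).hom = 0) :
    matrixOfIdeal eI W (T * A) hTA = T.map (red j i W) * matrixOfIdeal eI W A hA :=
  matrix_map_toIdeal_injective eI W (by
    simp only [map_toIdeal_matrixOfIdeal]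
    rw [← mul_map_toIdeal, map_toIdeal_matrixOfIdeal])

/-- **`matrixOfIdeal (A · T) = matrixOfIdeal A · T̄`.** [folklore] -/
theorem matrixOfIdeal_mul_right [Fintype m] (W : Z₁.Opens) (A : Matrix o m Γ(Z₁, W))
    (T : Matrix m n Γ(Z₁, W)) (hA : A.map (i.app W).hom = 0) (hAT : (A * T).map (i.app W).hom = 0) :
    matrixOfIdeal eI W (A * T) hAT = matrixOfIdeal eI W A hA * T.map (red j i W) :=
  matrix_map_toIdeal_injective eI W (by
    simp only [map_toIdeal_matrixOfIdeal]
    rw [← map_toIdeal_mul, map_toIdeal_matrixOfIdeal])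

/-- **`matrixOfIdeal` commutes with restriction.** [folklore] -/
theorem matrixOfIdeal_map {W W' : Z₁.Opens} (h : W' ≤ W) (A : Matrix m n Γ(Z₁, W))
    (hA : A.map (i.app W).hom = 0) (hA' : (A.map (secRes Z₁ h)).map (i.app W').hom = 0) :
    (matrixOfIdeal eI W A hA).map
        (secRes Y ((Opens.map j.base).map ((Opens.map i.base).map (homOfLE h))).le) =
      matrixOfIdeal eI W' (A.map (secRes Z₁ h)) hA' :=
  matrix_map_toIdeal_injective eI W' (by
    simp only [map_toIdeal_matrixOfIdeal]
    ext a b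
    simp only [Matrix.map_apply]
    rw [← toIdeal_map, matrixOfIdeal, Matrix.of_apply, toIdeal_ofIdeal])

end Matrix

end Literature.AlgebraicGeometry.Deformation

end
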